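import Literature.MathematicalPhysics.QuantumFieldTheory.ConstructiveQFTWave0OddRPProofs
import Literature.MathematicalPhysics.QuantumFieldTheory.LatticeGaugeStaticPotentialProofs
import Literature.MathematicalPhysics.QuantumFieldTheory.LatticeGaugeProofs

/-!
# Candidate proof of STUB 1 `stub_oddTorusRP` (line `sup-axis-reflection-transfer`, crux stmt-QuantumFields-9442)

Transport of the proved tree theorem `wilsonExpectation_oddReflectionPositive` (odd torus, `θ t = 1 - t`,
`β ≥ 0`, continuous `ρ`) through the measure-preserving torus symmetries `configPerm π`
(`wilsonMeasure_map_configPerm`) and `torusConfigShift v` (`wilsonMeasure_map_torusConfigShift`).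
drefute seat refuter-drefute-stmt-QuantumFields-9442-0 (positive by-product, attached as item evidence; a prover lands it).
-/

noncomputable section

open MeasureTheory
open scoped ComplexOrder ComplexConjugate
open Literature.MathematicalPhysics.QuantumFieldTheory

namespace Summit.QuantumFields.YangMills.Cruxes.FiniteSusceptibilityWeakCoupling.SupAxisReflectionTransfer.OddTorusRPProof

/-- **STUB 1 (`OddTorusRPAllPlanes`), verbatim statement of the registered `stub_oddTorusRP`.** [folklore] -/
theorem oddTorusRP : ∀ (G : Type) [Group G] [TopologicalSpace G] [IsTopologicalGroup G] [CompactSpace G] [MeasurableSpace G] [BorelSpace G] (N : ℕ) (ρ : G →* Matrix (Fin N) (Fin N) ℂ), Continuous ρ → ∀ (β : ℝ), 0 ≤ β → ∀ (S : ℕ), 1 ≤ S → ∀ (π : Equiv.Perm (Fin 4)) (v : Literature.MathematicalPhysics.QuantumFieldTheory.Site 4 (2 * S + 1)) (F : Literature.MathematicalPhysics.QuantumFieldTheory.GaugeConfig 4 (2 * S + 1) G → ℝ), Measurable F → (∃ C : ℝ, ∀ U, |F U| ≤ C) → DependsOn F {e : Literature.MathematicalPhysics.QuantumFieldTheory.Edge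 4 (2 * S + 1) | Literature.MathematicalPhysics.QuantumFieldTheory.WilsonOddRP.IsOPosEdge (Literature.MathematicalPhysics.QuantumFieldTheory.sitePerm π.symm (e.1 - v), π.symm e.2) ∨ Literature.MathematicalPhysics.QuantumFieldTheory.WilsonOddRP.IsOSharedEdge (Literature.MathematicalPhysics.QuantumFieldTheory.sitePerm π.symm (e.1 - v), π.symm e.2)} → 0 ≤ ∫ U, F (Literature.MathematicalPhysics.QuantumFieldTheory.torusConfigShift v (Literature.MathematicalPhysics.QuantumFieldTheory.configPerm π (Literature.MathematicalPhysics.QuantumFieldTheory.GaugeConfig.timeReflect (Literature.MathematicalPhysics.QuantumFieldTheory.configPerm π.symm (Literature.MathematicalPhysics.QuantumFieldTheory.torusConfigShift (-v) U))))) * F U ∂(Literature.MathematicalPhysics.QuantumFieldTheory.wilsonMeasure (d := 4) (L := 2 * S + 1) ρ β) := by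
  intro G _ _ _ _ _ _ N ρ hρ β hβ S hS π v F hFm hFb hFdep
  have hL : Odd (2 * S + 1) := odd_two_mul_add_one S
  have hL3 : 3 ≤ 2 * S + 1 := by omega
  -- the transport map `Φ = τ_v ∘ π_*` as a measurable equivalence, and its inverse
  set e : GaugeConfig 4 (2 * S + 1) G ≃ᵐ GaugeConfig 4 (2 * S + 1) G :=
    (configPerm π).trans (torusConfigShift v) with he_def
  have he : ∀ U, e U = torusConfigShift v (configPerm π U) := fun U => rfl
  have hinv : ∀ U : GaugeConfig 4 (2 * S + 1) G,
      configPerm π.symm (torusConfigShift (-v) (torusConfigShift v (configPerm π U))) = U := by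
    intro U
    funext x
    simp only [configPerm_apply, torusConfigShift_apply, Equiv.symm_symm, sub_neg_eq_add,
      add_sub_cancel_right]
    have h1 : sitePerm π.symm (sitePerm π x.1) = x.1 := by ext j; simp
    rw [h1, Equiv.symm_apply_apply]
  -- the complexified, transported observable satisfies the hypotheses of the tree theorem
  set Fc : GaugeConfig 4 (2 * S + 1) G → ℂ := fun U => ((F (e U) : ℝ) : ℂ) with hFc_def
  have hFcm : Measurable Fc := Complex.measurable_ofReal.comp (hFm.comp e.measurable)
  have hFcb : ∃ C : ℝ, ∀ U, ‖Fc U‖ ≤ C := by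
    obtain ⟨C, hC⟩ := hFb
    refine ⟨C, fun U => ?_⟩
    rw [hFc_def]
    simp only [Complex.norm_real, Real.norm_eq_abs]
    exact hC _
  have hFcdep : DependsOn Fc ((WilsonOddRP.oPosEdges ∪ WilsonOddRP.oSharedEdges :
      Finset (Edge 4 (2 * S + 1))) : Set (Edge 4 (2 * S + 1))) := by
    intro U V hUV
    simp only [hFc_def]
    congr 1
    apply hFdep
    intro x hx
    rw [he, he]
    simp only [torusConfigShift_apply, configPerm_apply]
    apply hUV
    simp only [Finset.coe_union, Set.mem_union, Finset.mem_coe, WilsonOddRP.mem_oPosEdges,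
      WilsonOddRP.mem_oSharedEdges]
    exact hx
  have hRP := wilsonExpectation_oddReflectionPositive (d := 4) (L := 2 * S + 1) ρ hL hL3 hρ hβ Fc
    hFcm hFcb hFcdep
  -- it is a real integral
  unfold wilsonExpectation at hRP
  have hint : (∫ U, conj (Fc U.timeReflect) * Fc U
        ∂(wilsonMeasure (d := 4) (L := 2 * S + 1) ρ β)) =
      ((∫ U, F (e U.timeReflect) * F (e U) ∂(wilsonMeasure (d := 4) (L := 2 * S + 1) ρ β) : ℝ) : ℂ) := by
    rw [← integral_complex_ofReal]
    refine integral_congr_ae (ae_of_all _ fun U => ?_)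
    simp only [hFc_def, Complex.conj_ofReal, Complex.ofReal_mul]
  rw [hint, Complex.zero_le_real] at hRP
  -- invariance of the torus Wilson state under `e`
  have hmap : (wilsonMeasure (d := 4) (L := 2 * S + 1) ρ β).map e =
      wilsonMeasure (d := 4) (L := 2 * S + 1) ρ β := by
    have hcoe : (e : GaugeConfig 4 (2 * S + 1) G → GaugeConfig 4 (2 * S + 1) G) =
        (torusConfigShift v) ∘ (configPerm π) := rfl
    rw [hcoe, ← Measure.map_map (torusConfigShift v).measurable (configPerm π).measurable,
      wilsonMeasure_map_configPerm ρ hρ β π, wilsonMeasure_map_torusConfigShift ρ β v]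
  -- change of variables `U = e U'`
  have hcov : ∫ U, F (torusConfigShift v (configPerm π (GaugeConfig.timeReflect
        (configPerm π.symm (torusConfigShift (-v) U))))) * F U
        ∂(wilsonMeasure (d := 4) (L := 2 * S + 1) ρ β) =
      ∫ U, F (e U.timeReflect) * F (e U) ∂(wilsonMeasure (d := 4) (L := 2 * S + 1) ρ β) := by
    conv_lhs => rw [← hmap]
    rw [integral_map_equiv]
    refine integral_congr_ae (ae_of_all _ fun U => ?_)
    simp only [he, hinv]
  rw [hcov]
  exact hRP

end Summit.QuantumFields.YangMills.Cruxes.FiniteSusceptibilityWeakCoupling.SupAxisReflectionTransfer.OddTorusRPProof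

end
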